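import Mathlib
import HarnessLib

/-!
# Generalized (bracket) polynomials and the existence of their exponential-sum limits (Bergelson–Leibman 2007)

Topic `NumberTheory/DiophantineApproximation` (uniform distribution mod 1; next to `KroneckerWeyl.lean`,
`WeylCriterionArcs.lean`, `LeVequeInequality.lean`). A definition and a NAMED FACT (D-0014,
`def … : Prop`, not asserted, no `sorry`), requested while grounding route
`Schanuel/Schanuel/BenfordTowers` (ledger `route-Schanuel-BenfordTowers`; cruxes `BenfordFamily` =
stmt-Schanuel-11400 and `HomOfBenford` = stmt-Schanuel-11398): the digit-count tower statistics of
that route, `n ↦ Σ c·e_k(n)·log_B a` with `e₀ = n`, `e_j = #digits_B(p_j^{e_{j-1}}) = ⌊e_{j-1}·log_B p_j⌋ + 1`,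
are GENERALIZED POLYNOMIALS in `n` in the sense below (polynomials, `+`, `×`, integer part), so the
fact gives the EXISTENCE of the Cesàro limits `lim N⁻¹ Σ_{n<N} e(h·statistic(n))` (the "limit law" of
the route's thesis) — the route's items assert WHICH value (zero or not) that limit takes.

## Source and what is printed

V. Bergelson, A. Leibman, *Distribution of values of bounded generalized polynomials*, Acta Math.
198 (2007) 155–230 [BergelsonLeibman2007] (held text `paper:doi-10-1007-s11511-007-0015-y`, read
2026-08-15, PDF pp. 2, 5–6 = printed pp. 156, 164–167):

* §0.1 (p. 156): "the class GP of generalized polynomials, namely the class of functions which is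
  generated by starting with conventional polynomials of one or several variables and applying in
  arbitrary order the operations of taking the integer part …, addition, and multiplication. … For a
  fixed `d ∈ ℕ` let `GP₀` denote the ring of polynomial mappings from either `ℤ^d` or `ℝ^d` to `ℝ`, and
  let `GP = ⋃_n GP_n`, where, for `n ≥ 1`, `GP_n = GP_{n-1} ∪ {v + w : v, w ∈ GP_{n-1}} ∪
  {vw : v, w ∈ GP_{n-1}} ∪ {[v] : v ∈ GP_{n-1}}`."
* §0.21–0.22 (p. 166): densities and "well distributed" are taken along Følner sequences `{Φ_N}` of
  finite subsets of `ℤ^d` ("A standard example of a Følner sequence is provided by a sequence of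
  … cubes of increasing size in `ℤ^d`").
* **Theorem B** (§0.24, p. 166): "Let `u : ℤ^d → ℝ^l` be a bounded GP mapping. There exists a
  bounded piecewise polynomial surface `S` such that `u(n) ∈ S` for almost all `n ∈ ℤ^d` and the
  sequence `{u(n)}` is well distributed on `S` with respect to `μ_S`."
* **Corollary 0.25** (p. 167): "Let `u : ℤ^d → ℝ^l` be a bounded GP mapping. For any `f ∈ C(ℝ^l)`
  and any Følner sequence `{Φ_N}` in `ℤ^d`, `lim_{N→∞} |Φ_N|⁻¹ Σ_{n ∈ Φ_N} f(u(n))` exists and is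
  equal to `∫_S f dμ_S`."
* **Corollary 0.26** (p. 167): "For any generalized polynomial `u : ℤ^d → ℝ` and any Følner sequence
  `{Φ_N}` in `ℤ^d`, `lim_{N→∞} |Φ_N|⁻¹ Σ_{n ∈ Φ_N} e^{2πiu(n)}` exists. Note that the generalized
  polynomial `u` is not assumed to be bounded, but this does not matter in view of the identity
  `e^{2πiu(n)} = e^{2πi{u(n)}}`."

## Design

* Only `d = 1`, integer argument: `IsGeneralizedPolynomial u` for `u : ℤ → ℝ` is the inductive
  closure of §0.1 — polynomial maps `n ↦ p(n)` (`p ∈ ℝ[X]`), sums, products, integer parts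
  (`⌊·⌋`, cast back to `ℝ`). Subtraction and rational/real scalars come from products with constant
  polynomials; `{v} = v - [v]`.
* Følner sequences of `ℤ` are written out: finite sets `Φ N`, eventually non-empty, with
  `|Φ_N ∆ (Φ_N + 1)| / |Φ_N| → 0` (for `ℤ = ⟨1⟩` this is the Følner condition; the initial
  segments `{0, …, N-1}` and any intervals of length `→ ∞` qualify).
* The fact is Corollary 0.26 with the limit identified as in Corollary 0.25 (applied to the bounded
  GP mapping `{u}` and `f = e^{2πix}`): ONE limit `c = ∫_S e^{2πix} dμ_S(x)` serves every Følner
  sequence. The surface `S`/measure `μ_S` of Theorem B are not typed (that would need piecewise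
  polynomial surfaces); only the existence and Følner-independence of the limit is recorded, which is
  what the requesting route uses.
* Mathlib / tree search (2026-08-15): Mathlib has `Int.floor`, `Polynomial.eval`, ergodicity of
  `×n` on `AddCircle` (`AddCircle.ergodic_zsmul`) but no uniform-distribution-mod-1 theory, no Weyl
  equidistribution theorem for `nα` or polynomials, no generalized polynomials (searched
  `equidistrib`, `Weyl`, `bracket`, `fract.*Tendsto`); tree: `KroneckerWeyl.lean` (linear FLOWS on
  tori, proved), `WeylCriterionArcs.lean` (Weyl sums ⇒ arc counts, proved), `KroneckerTheorem.lean`,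
  `LeVequeInequality.lean` — none for bracket polynomials. Users take
  `(h : BergelsonLeibman2007_cor_0_26)`.

## References

* [BergelsonLeibman2007] V. Bergelson, A. Leibman, *Distribution of values of bounded generalized
  polynomials*, Acta Math. 198 (2007), 155–230, §0.1, Theorem B (§0.24), Corollaries 0.25–0.26.
  doi:10.1007/s11511-007-0015-y
* [Haland1993] I. J. Håland, *Uniform distribution of generalized polynomials*, J. Number Theory 45
  (1993) 327–366 (the `[nα]β`-type criteria).
* [Weyl1916] H. Weyl, *Über die Gleichverteilung von Zahlen mod. Eins*, Math. Ann. 77 (1916).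
-/

noncomputable section

namespace Literature.NumberTheory.DiophantineApproximation

open Filter Finset
open scoped symmDiff

/-- **Generalized polynomials** `ℤ → ℝ` (Bergelson–Leibman, §0.1, the case `d = 1` of integer
argument): the smallest class of functions containing the polynomial maps `n ↦ p(n)` (`p ∈ ℝ[X]`)
and closed under addition, multiplication and taking the integer part.
[cite: BergelsonLeibman2007, §0.1] -/
inductive IsGeneralizedPolynomial : (ℤ → ℝ) → Prop
  | poly (p : Polynomial ℝ) : IsGeneralizedPolynomial fun n => p.eval (n : ℝ)
  | add {u v : ℤ → ℝ} : IsGeneralizedPolynomial u → IsGeneralizedPolynomial v →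
      IsGeneralizedPolynomial (u + v)
  | mul {u v : ℤ → ℝ} : IsGeneralizedPolynomial u → IsGeneralizedPolynomial v →
      IsGeneralizedPolynomial (u * v)
  | floor {u : ℤ → ℝ} : IsGeneralizedPolynomial u → IsGeneralizedPolynomial fun n => (⌊u n⌋ : ℝ)

/-- Constant functions are generalized polynomials. [cite: BergelsonLeibman2007, §0.1] -/
theorem IsGeneralizedPolynomial.const (c : ℝ) : IsGeneralizedPolynomial fun _ => c := by
  simpa using IsGeneralizedPolynomial.poly (Polynomial.C c)

/-- The identity `n ↦ n` is a generalized polynomial. [cite: BergelsonLeibman2007, §0.1] -/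
theorem IsGeneralizedPolynomial.id : IsGeneralizedPolynomial fun n : ℤ => (n : ℝ) := by
  simpa using IsGeneralizedPolynomial.poly (Polynomial.X)

/-- Generalized polynomials are closed under negation (`-u = (-1)·u`).
[cite: BergelsonLeibman2007, §0.3] -/
theorem IsGeneralizedPolynomial.neg {u : ℤ → ℝ} (hu : IsGeneralizedPolynomial u) :
    IsGeneralizedPolynomial (-u) := by
  have h := IsGeneralizedPolynomial.mul (IsGeneralizedPolynomial.const (-1)) hu
  convert h using 1
  funext n
  simp

/-- Generalized polynomials are closed under subtraction. [cite: BergelsonLeibman2007, §0.3] -/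
theorem IsGeneralizedPolynomial.sub {u v : ℤ → ℝ} (hu : IsGeneralizedPolynomial u)
    (hv : IsGeneralizedPolynomial v) : IsGeneralizedPolynomial (u - v) := by
  simpa [sub_eq_add_neg] using hu.add hv.neg

/-- The fractional part `{u} = u - [u]` of a generalized polynomial is a (bounded) generalized
polynomial. [cite: BergelsonLeibman2007, §0.1] -/
theorem IsGeneralizedPolynomial.fract {u : ℤ → ℝ} (hu : IsGeneralizedPolynomial u) :
    IsGeneralizedPolynomial fun n => Int.fract (u n) := by
  have h := hu.sub hu.floor
  convert h using 1
  funext n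
  rfl

/-- A **Følner sequence of `ℤ`**, written out for the generator `1`: finite sets `Φ N`, eventually
non-empty, almost invariant under the shift `n ↦ n + 1`:
`|Φ_N ∆ (Φ_N + 1)| / |Φ_N| → 0` (§0.21: "A standard example of a Følner sequence is provided by a
sequence of … cubes of increasing size in `ℤ^d`"). [cite: BergelsonLeibman2007, §0.21] -/
def IsFoelnerSeq (Φ : ℕ → Finset ℤ) : Prop :=
  (∀ᶠ N in atTop, (Φ N).Nonempty) ∧
    Tendsto (fun N => (((Φ N) ∆ ((Φ N).image fun n => n + 1)).card : ℝ) / (Φ N).card) atTop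
      (nhds 0)

/-- **Bergelson–Leibman 2007, Corollary 0.26 (with the limit of Corollary 0.25).** "For any
generalized polynomial `u : ℤ^d → ℝ` and any Følner sequence `{Φ_N}` in `ℤ^d`,
`lim_{N → ∞} |Φ_N|⁻¹ Σ_{n ∈ Φ_N} e^{2πiu(n)}` exists" — and by Corollary 0.25 (applied to the
bounded GP mapping `{u}` and the continuous `f(x) = e^{2πix}`) the limit equals
`∫_S e^{2πix} dμ_S(x)` for the piecewise polynomial surface `S` of Theorem B, hence does not depend
on the Følner sequence. Typed for `d = 1`: for every generalized polynomial `u : ℤ → ℝ` there is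
`c ∈ ℂ` such that for every Følner sequence `Φ` of `ℤ`,
`|Φ_N|⁻¹ Σ_{n ∈ Φ_N} e^{2πiu(n)} → c`. (Consequence for the requesting route: every digit-count
tower statistic has a limit law for its Weyl sums along `{0, …, N-1}`; `BenfordFamily` /
`HomOfBenford` decide when `c = 0`.)
[cite: BergelsonLeibman2007, Corollaries 0.25–0.26] -/
def BergelsonLeibman2007_cor_0_26 : Prop :=
  ∀ u : ℤ → ℝ, IsGeneralizedPolynomial u → ∃ c : ℂ, ∀ Φ : ℕ → Finset ℤ, IsFoelnerSeq Φ →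
    Tendsto (fun N => ((Φ N).card : ℂ)⁻¹ *
      ∑ n ∈ Φ N, Complex.exp (2 * Real.pi * Complex.I * (u n : ℂ))) atTop (nhds c)

end Literature.NumberTheory.DiophantineApproximation

end
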